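import Summits.BirchSwinnertonDyer.BirchSwinnertonDyer.Theorems.ByReductionTypeAtTwoOrdKatoHalfAtTwoIsoGreenbergMuDefs
import Summits.BirchSwinnertonDyer.BirchSwinnertonDyer.Theorems.ByReductionTypeAtTwoOrdKatoHalfAtTwoIsoHintOfAbbesUllmo
import Summits.BirchSwinnertonDyer.Rank1Residual.X5.KatoOrdTwoMuPart
import Literature.NumberTheory.EllipticCurves.IsogenyIdProofs
import HarnessLib

/-!
# Cert52b — crux-triage r1 seat 2 (GEN 52), crux `OrdKatoHalfAtTwoIso` (stmt-BirchSwinnertonDyer-19573), line `steinberg-fibre-at-two`: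
# THE DIRECT ROAD IS SIGN-FREE — Greenberg's `μ = 0` at `2` ALONE closes the crux conjunct on the WHOLE `ρ̄₂`-onto locus (`W′ := W`),
# in particular on the `Δ < 0` cell WITHOUT the memo road (no V♭⁻, no F1μι⁻, no carriers, no Coleman map); ROUTE-FILE-FREE.

HONEST FRAMING (cell bsd-2adic): BSD is not proved by any of this; crux 202 is not proved; G11 (Greenberg LNM 1716 Conj. 1.11 at `p = 2` on
the locus [non-CM · r_an = 0 · good ordinary at 2 · ρ̄₂ onto], either sign of `Δ`) is an OPEN published conjecture — below it is only ever a
HYPOTHESIS. THEOREMS + local `def`s (texts for quoting); no `sorry`, no instance, no axiom, no Literature fact.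

Why this file (pre-arm of acceptance rule §B for the ANNOUNCED split «V♭⁻ ⟺ G11⁻ ∧ MU13⁻», w3 GEN 7, HOME STATUS 17:23Z):
* §1 `G11onto` (= the CONCLUSION TEXT of the v24 skeleton's sign-free necessity `greenbergMu_two_onto_necessary`, :782) splits by the sign of
  `Δ` into the landed `GreenbergMuZeroTwoOrdPosDisc` (p733065) and its `Δ < 0` twin `G11neg` — `g11onto_iff` (uses only `Δ ≠ 0` on an elliptic curve, `W.isUnit_Δ.ne_zero`).
* §2 `ontoBody_of_g11onto` / `negDiscBody_of_g11neg` — the v24 direct road `posDisc_of_greenbergMu` (:540–555) with the hypothesis `0 < W.Δ`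
  ERASED, through the same LANDED doors `O1.katoMuPartAtTwo_of_mu_eq_zero`, `O1.mainConjectureLowerDivisibilityAtTwoOrd_of_katoMuPartAtTwo`,
  `hint_two_of_abbesUllmo_of_irr`: none of them reads the sign of `Δ`. CONSEQUENCE for triage (information, zero ask): for the CRUX CONJUNCT the
  registered research content of the onto locus is exactly G11 (both signs, necessity is v24 :782); the `Δ < 0` memo road (V♭⁻ → F1μι⁻) is the
  line's MECHANISM for G11⁻ and the input of the PAIR child 24097's first conjunct (F1μι⁻), not an extra requirement of the crux conjunct; a stub
  «MU13⁻» co-registered with G11⁻ is consumed only through F1μι⁻ (24097.1), never by `OrdKatoHalfAtTwoIso_of`'s `Δ < 0` branch if that branch is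
  re-keyed to this road.

References: R. Greenberg, in LNM 1716 (1999), Conj. 1.11 p. 64 [GreenbergLNM1716]; K. Kato, Astérisque 295 (2004) Thm. 17.4 [Kato2004Asterisque];
A. Abbes, E. Ullmo, Compositio Math. 103 (1996) Thm. A [AbbesUllmo1996]; tree: p733065 `…OrdKatoHalfAtTwoIsoGreenbergMuDefs`, K4
`Rank1Residual/X5/KatoOrdTwoMuPart`, line `…HintOfAbbesUllmo`; v24 skeleton `Cruxes/OrdKatoHalfAtTwoIso/Lines/steinberg_fibre_at_two.lean`
@4921f2ec (:540 `posDisc_of_greenbergMu`, :782 `greenbergMu_two_onto_necessary`).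
-/

set_option autoImplicit false
set_option linter.dupNamespace false

noncomputable section

open scoped Classical MatrixGroups ModularForm

open CongruenceSubgroup WeierstrassCurve Field
  Literature.NumberTheory.GaloisRepresentations
  Literature.NumberTheory.EllipticCurves
  Literature.NumberTheory.EllipticCurves.ModularForms
  Literature.NumberTheory.EllipticCurves.Rank1Residual
  Literature.NumberTheory.EllipticCurves.SkinnerUrban2014
  Summit.BirchSwinnertonDyer.Rank1Residual.X5
open Summit.BirchSwinnertonDyer.BirchSwinnertonDyer.Theorems.SteinbergFibreAtTwo

namespace Summit.BirchSwinnertonDyer.BirchSwinnertonDyer.Cruxes.OrdKatoHalfAtTwoIso.Cert52b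

/-! ### §1 The sign-free Greenberg sentence on the onto locus and its split by the sign of `Δ` -/

/-- [RESEARCH, OPEN — quoted, not asserted] **G11 (sign-free)**: Greenberg's `μ = 0` at `2` for every cyclotomic strict Selmer dual datum of every
curve of the locus [non-CM · r_an = 0 · good ordinary at 2 · ρ̄₂ onto] — VERBATIM the conclusion of the v24 skeleton's
`greenbergMu_two_onto_necessary` (:782–787). [cite: GreenbergLNM1716, Conj. 1.11 (p. 64) (shape only)] -/
def G11onto : Prop :=
  ∀ (W : WeierstrassCurve ℚ) [W.IsElliptic] [W.IsGloballyMinimal],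
      ¬ W.HasCM → W.analyticRank = 0 → GoodOrd W 2 → W.HasSurjectiveModNGaloisRep 2 →
      ∀ (κ : ZpExtension ℚ 2) (γ : absoluteGaloisGroup ℚ), κ.IsCyclotomic → κ.IsTopGenerator γ →
        IsCyclotomicVariable 2 γ → ∀ D : W.SelmerDualData κ γ, D.mu = 0

/-- [RESEARCH, OPEN — quoted, not asserted] **G11⁻**: the `Δ < 0` twin of the landed `GreenbergMuZeroTwoOrdPosDisc` (p733065) — the same
binder list with `0 < W.Δ` replaced by `W.Δ < 0` (w3 GEN 7's announced «G11⁻», HOME STATUS 17:23Z, read from the announcement; the landed text,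
if any, is compared at registration). [cite: GreenbergLNM1716, Conj. 1.11 (p. 64) (shape only)] -/
def G11neg : Prop :=
  ∀ (W : WeierstrassCurve ℚ) [W.IsElliptic] [W.IsGloballyMinimal],
      ¬ W.HasCM → W.analyticRank = 0 → GoodOrd W 2 → W.HasSurjectiveModNGaloisRep 2 → W.Δ < 0 →
      ∀ (κ : ZpExtension ℚ 2) (γ : absoluteGaloisGroup ℚ), κ.IsCyclotomic → κ.IsTopGenerator γ →
        IsCyclotomicVariable 2 γ → ∀ D : W.SelmerDualData κ γ, D.mu = 0

/-- **G11 (sign-free) ⟺ G11⁺ ∧ G11⁻** — the only arithmetic used is `Δ ≠ 0` on an elliptic curve (`W.isUnit_Δ.ne_zero`), so the two registered /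
announced sign cells COVER the onto locus with no sliver left. [folklore] -/
theorem g11onto_iff : G11onto ↔ GreenbergMuZeroTwoOrdPosDisc ∧ G11neg := by
  constructor
  · intro h
    exact ⟨fun W _ _ hcm hr hgo h2 _ κ γ hκ hγ hγ' D => h W hcm hr hgo h2 κ γ hκ hγ hγ' D,
      fun W _ _ hcm hr hgo h2 _ κ γ hκ hγ hγ' D => h W hcm hr hgo h2 κ γ hκ hγ hγ' D⟩
  · rintro ⟨hpos, hneg⟩ W _ _ hcm hr hgo h2 κ γ hκ hγ hγ' D
    rcases lt_or_gt_of_ne W.isUnit_Δ.ne_zero with hΔ | hΔ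
    · exact hneg W hcm hr hgo h2 hΔ κ γ hκ hγ hγ' D
    · exact hpos W hcm hr hgo h2 hΔ κ γ hκ hγ hγ' D

/-! ### §2 The direct road with the sign hypothesis ERASED (route-file-free; every door LANDED) -/

/-- [RESEARCH, OPEN — quoted, not asserted] The crux `OrdKatoHalfAtTwoIso` RESTRICTED to the `ρ̄₂`-onto locus, sign-free (`∃ W′` form verbatim
as in the route decl). [cite: Kato2004Asterisque, Thm. 17.4 (p. 273) (shape only; nothing asserted)] -/
def OntoBody : Prop :=
  ∀ (W : WeierstrassCurve ℚ) [W.IsElliptic] [W.IsGloballyMinimal], ¬ W.HasCM → W.analyticRank = 0 →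
    Literature.NumberTheory.EllipticCurves.Rank1Residual.GoodOrd W 2 → W.HasSurjectiveModNGaloisRep 2 →
    ∃ (W' : WeierstrassCurve ℚ) (_ : W'.IsElliptic) (_ : W'.IsGloballyMinimal),
      WeierstrassCurve.IsIsogenous W W' ∧ Summit.BirchSwinnertonDyer.Rank1Residual.X5.O1.MainConjectureLowerDivisibilityAtTwoOrd W'

/-- [RESEARCH, OPEN — quoted, not asserted] The `Δ < 0` conjunct's body on the onto cell (`∃ W′` form). [cite: Kato2004Asterisque, Thm. 17.4 (p. 273) (shape only)] -/
def NegDiscBody : Prop :=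
  ∀ (W : WeierstrassCurve ℚ) [W.IsElliptic] [W.IsGloballyMinimal], ¬ W.HasCM → W.analyticRank = 0 →
    Literature.NumberTheory.EllipticCurves.Rank1Residual.GoodOrd W 2 → W.HasSurjectiveModNGaloisRep 2 → W.Δ < 0 →
    ∃ (W' : WeierstrassCurve ℚ) (_ : W'.IsElliptic) (_ : W'.IsGloballyMinimal),
      WeierstrassCurve.IsIsogenous W W' ∧ Summit.BirchSwinnertonDyer.Rank1Residual.X5.O1.MainConjectureLowerDivisibilityAtTwoOrd W'

/-- **Per curve, sign-free: `μ = 0` for every cyclotomic strict Selmer dual datum of `W` + Abbes–Ullmo + Kato 17.4 (1)(2) at `2` ⟹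
`O1.MainConjectureLowerDivisibilityAtTwoOrd W` AT `W` ITSELF**, on the good-ordinary `ρ̄₂`-onto locus — the doors of v24's `posDisc_of_greenbergMu`
verbatim; NONE of them mentions `Δ`. CONDITIONAL on the per-curve Greenberg matrix (OPEN in general); nothing closed.
[cite: Kato2004Asterisque, Thm. 17.4 (1)(2) (p. 273)] [cite: AbbesUllmo1996, Thm. A] -/
theorem mainConjectureLowerDivisibilityAtTwoOrd_of_mu_eq_zero (hAU : abbesUllmo_not_dvd_maninConstant_of_not_dvd_level)
    (W : WeierstrassCurve ℚ) [W.IsElliptic] [W.IsGloballyMinimal] (hgo : GoodOrd W 2) (h2 : W.HasSurjectiveModNGaloisRep 2)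
    (hμ : ∀ (κ : ZpExtension ℚ 2) (γ : absoluteGaloisGroup ℚ), κ.IsCyclotomic → κ.IsTopGenerator γ →
        IsCyclotomicVariable 2 γ → ∀ D : W.SelmerDualData κ γ, D.mu = 0)
    (h17 : ∀ [NeZero (W.conductorNorm ℤ)] (f : CuspForm (Gamma0 (W.conductorNorm ℤ)) 2),
      kato_divisibility_allPrimes W 2 (f := f)) :
    O1.MainConjectureLowerDivisibilityAtTwoOrd W := by
  haveI : NeZero ((2 : ℕ) : ℚ) := ⟨by norm_num⟩
  exact O1.mainConjectureLowerDivisibilityAtTwoOrd_of_katoMuPartAtTwo W h17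
    (fun f hf ϖ hϖ => hint_two_of_abbesUllmo_of_irr hAU W hgo
      (hasIrreducibleModPGaloisRep_of_hasSurjectiveModNGaloisRep W 2 h2) f hf ϖ hϖ)
    (O1.katoMuPartAtTwo_of_mu_eq_zero W fun κ γ hκ hγ hγ' D => hμ κ γ hκ hγ hγ' D)

/-- **THE DIRECT ROAD, SIGN-FREE: G11 (both signs) + Abbes–Ullmo + Kato 17.4 (1)(2) at `2` ⟹ the crux on the WHOLE onto locus, `W′ := W`.**
CONDITIONAL on G11 (OPEN); nothing closed. [cite: Kato2004Asterisque, Thm. 17.4 (1)(2) (p. 273)] [cite: AbbesUllmo1996, Thm. A]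
[cite: GreenbergLNM1716, Conj. 1.11 (p. 64) (shape of the hypothesis)] -/
theorem ontoBody_of_g11onto (hG : G11onto) (hAU : abbesUllmo_not_dvd_maninConstant_of_not_dvd_level)
    (h17 : ∀ (V : WeierstrassCurve ℚ) [V.IsElliptic] [V.IsGloballyMinimal] [NeZero (V.conductorNorm ℤ)]
      (f : CuspForm (Gamma0 (V.conductorNorm ℤ)) 2), kato_divisibility_allPrimes V 2 (f := f)) :
    OntoBody :=
  fun W _ _ hcm hr hgo h2 =>
    ⟨W, ‹_›, ‹_›, isIsogenous_self W,
      mainConjectureLowerDivisibilityAtTwoOrd_of_mu_eq_zero hAU W hgo h2 (hG W hcm hr hgo h2) (h17 W)⟩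

/-- **THE `Δ < 0` CELL FROM G11⁻ ALONE: G11⁻ + Abbes–Ullmo + Kato 17.4 (1)(2) at `2` ⟹ the `Δ < 0` conjunct's body, `W′ := W`** — the exact
twin of v24's `posDisc_of_greenbergMu`; no V♭⁻, no F1μι⁻, no `IwasawaH1Data` / `LocalIwasawaH1Data` carrier, no Coleman map, no functional.
CONDITIONAL on G11⁻ (OPEN); nothing closed. [cite: Kato2004Asterisque, Thm. 17.4 (1)(2) (p. 273)] [cite: AbbesUllmo1996, Thm. A]
[cite: GreenbergLNM1716, Conj. 1.11 (p. 64) (shape of the hypothesis)] -/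
theorem negDiscBody_of_g11neg (hG : G11neg) (hAU : abbesUllmo_not_dvd_maninConstant_of_not_dvd_level)
    (h17 : ∀ (V : WeierstrassCurve ℚ) [V.IsElliptic] [V.IsGloballyMinimal] [NeZero (V.conductorNorm ℤ)]
      (f : CuspForm (Gamma0 (V.conductorNorm ℤ)) 2), kato_divisibility_allPrimes V 2 (f := f)) :
    NegDiscBody :=
  fun W _ _ hcm hr hgo h2 hΔ =>
    ⟨W, ‹_›, ‹_›, isIsogenous_self W,
      mainConjectureLowerDivisibilityAtTwoOrd_of_mu_eq_zero hAU W hgo h2 (fun κ γ hκ hγ hγ' D => hG W hcm hr hgo h2 hΔ κ γ hκ hγ hγ' D) (h17 W)⟩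

/-- **Both sign cells at once from the two sign stubs** (what a v25 registering {G11⁺, G11⁻} would hand the glue for the onto locus).
CONDITIONAL on G11⁺ ∧ G11⁻ (OPEN); nothing closed. [folklore] -/
theorem ontoBody_of_pos_and_neg (hpos : GreenbergMuZeroTwoOrdPosDisc) (hneg : G11neg)
    (hAU : abbesUllmo_not_dvd_maninConstant_of_not_dvd_level)
    (h17 : ∀ (V : WeierstrassCurve ℚ) [V.IsElliptic] [V.IsGloballyMinimal] [NeZero (V.conductorNorm ℤ)]
      (f : CuspForm (Gamma0 (V.conductorNorm ℤ)) 2), kato_divisibility_allPrimes V 2 (f := f)) :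
    OntoBody :=
  ontoBody_of_g11onto (g11onto_iff.mpr ⟨hpos, hneg⟩) hAU h17

end Summit.BirchSwinnertonDyer.BirchSwinnertonDyer.Cruxes.OrdKatoHalfAtTwoIso.Cert52b

end
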